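import Literature.AlgebraicGeometry.KTheory.PullbackVectorBundle
import Literature.AlgebraicGeometry.Modules.SheafHomFunctor
import HarnessLib

/-!
# Frames of `𝒪_X`-modules over an open, section-wise (transport; the standard frame of `𝒪^ι`)

Helper file for stub `stub_pushforwardTransport` (line `chow-zariski-pushforward` of the crux
`PadicSemiregularLift.FormalVectorBundlesAlgebraize`, stmt-HodgeConjecture-14106).

A *frame* of an `𝒪_X`-module `M` over an open `U` is a finite family of sections
`b i ∈ Γ(M, U)` such that for every open `V ≤ U` the map
`(ι → Γ(X, V)) → Γ(M, V)`, `a ↦ ∑ i, a i • b i|_V` is bijective. No definition is introduced: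
the property is spelled out in every statement. This file proves

* frames transport along morphisms bijective on sections and along isomorphisms, restrict to
  smaller opens, and are insensitive to replacing an open by an equal one; a morphism mapping a
  frame to a frame is bijective on sections;
* the standard sections `ιᵢ(1)` of `𝒪^ι = ∐ 𝒪` form a frame over every open, and a frame over
  `⊤` is the image of the standard frame under an isomorphism `𝒪^ι ≅ M`.

Everything is proved; no definitions.

Provenance: Literature home (family `hodge`, layer `Literature/AlgebraicGeometry/FormalGeometry`, namespace
`Literature.AlgebraicGeometry.FormalGeometry.WittGrothendieckExistence…`) of the Summits-side
`Theorems/PadicSemiregularLiftFormalVectorBundlesAlgebraizeFrames` (route `PadicSemiregularLift` / `AnchorTransport`,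
Grothendieck existence for vector bundles over `W(k)`), which `Literature/` may not import; theorems only, no
named fact, no definition. Lane `lit-hodgefound`, seat p20.
-/

noncomputable section

open CategoryTheory CategoryTheory.Limits _root_.AlgebraicGeometry TopologicalSpace Opposite
open Literature.AlgebraicGeometry.Modules Literature.AlgebraicGeometry.Motives

universe u

namespace Literature.AlgebraicGeometry.FormalGeometry.WittGrothendieckExistence.FormalVectorBundlesAlgebraize

variable {X : Scheme.{u}}

/-! ### Sums, composites and isomorphisms on sections -/

/-- Composites act on sections by composition. [cite: GortzWedhorn2023, proof of Thm. 24.94 and Prop. 24.95 (pp. 566–567), auxiliary step] -/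
theorem app_comp_apply {M N K : X.Modules} (φ : M ⟶ N) (ψ : N ⟶ K) (U : X.Opens)
    (x : Γ(M, U)) : (φ ≫ ψ).app U x = ψ.app U (φ.app U x) := rfl

/-- A finite sum of morphisms acts on sections by the sum. [cite: GortzWedhorn2023, proof of Thm. 24.94 and Prop. 24.95 (pp. 566–567), auxiliary step] -/
theorem sum_app_apply {M N : X.Modules} {α : Type*} (s : Finset α) (φ : α → (M ⟶ N))
    (U : X.Opens) (m : Γ(M, U)) :
    (∑ a ∈ s, φ a).app U m = ∑ a ∈ s, (φ a).app U m := by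
  classical
  induction s using Finset.induction_on with
  | empty => simp [Scheme.Modules.Hom.zero_app]
  | insert a s ha ih =>
    rw [Finset.sum_insert ha, Finset.sum_insert ha, Scheme.Modules.Hom.add_app, ← ih]
    rfl

/-- An isomorphism of modules is bijective on sections. [cite: GortzWedhorn2023, proof of Thm. 24.94 and Prop. 24.95 (pp. 566–567), auxiliary step] -/
theorem app_bijective_of_iso {M N : X.Modules} (e : M ≅ N) (U : X.Opens) :
    Function.Bijective (e.hom.app U) := by
  refine Function.bijective_iff_has_inverse.mpr ⟨e.inv.app U, fun m => ?_, fun n => ?_⟩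
  · change (e.hom ≫ e.inv).app U m = m
    rw [e.hom_inv_id]
    rfl
  · change (e.inv ≫ e.hom).app U n = n
    rw [e.inv_hom_id]
    rfl

/-- A morphism applied to a linear combination of restricted sections. [cite: GortzWedhorn2023, proof of Thm. 24.94 and Prop. 24.95 (pp. 566–567), auxiliary step] -/
theorem app_sum_smul_map {M N : X.Modules} (φ : M ⟶ N) {ι : Type*} [Fintype ι] {U V : X.Opens}
    (hV : V ≤ U) (b : ι → Γ(M, U)) (a : ι → Γ(X, V)) :
    φ.app V (∑ i, a i • M.presheaf.map (homOfLE hV).op (b i)) =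
      ∑ i, a i • N.presheaf.map (homOfLE hV).op (φ.app U (b i)) := by
  rw [map_sum]
  refine Finset.sum_congr rfl fun i _ => ?_
  rw [Scheme.Modules.Hom.app_smul, Scheme.Modules.Hom.app_map_apply]

/-! ### Transport of frames -/

section Transport

variable {ι : Type*} [Fintype ι]

/-- **A frame is carried to a frame by a morphism bijective on sections.** [cite: GortzWedhorn2023, proof of Thm. 24.94 and Prop. 24.95 (pp. 566–567), auxiliary step] -/
theorem frame_map_of_app_bijective {M N : X.Modules} (φ : M ⟶ N) {U : X.Opens}
    (b : ι → Γ(M, U))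
    (hb : ∀ (V : X.Opens) (hV : V ≤ U), Function.Bijective fun a : ι → Γ(X, V) =>
      ∑ i, a i • M.presheaf.map (homOfLE hV).op (b i))
    (hφ : ∀ (V : X.Opens), V ≤ U → Function.Bijective (φ.app V)) :
    ∀ (V : X.Opens) (hV : V ≤ U), Function.Bijective fun a : ι → Γ(X, V) =>
      ∑ i, a i • N.presheaf.map (homOfLE hV).op (φ.app U (b i)) := by
  intro V hV
  have heq : (fun a : ι → Γ(X, V) => ∑ i, a i • N.presheaf.map (homOfLE hV).op (φ.app U (b i))) =
      φ.app V ∘ fun a : ι → Γ(X, V) => ∑ i, a i • M.presheaf.map (homOfLE hV).op (b i) := by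
    funext a
    exact (app_sum_smul_map φ hV b a).symm
  rw [heq]
  exact (hφ V hV).comp (hb V hV)

/-- **A morphism carrying a frame to a frame is bijective on sections** over the opens below. [cite: GortzWedhorn2023, proof of Thm. 24.94 and Prop. 24.95 (pp. 566–567), auxiliary step] -/
theorem app_bijective_of_frame_of_frame {M N : X.Modules} (φ : M ⟶ N) {U : X.Opens}
    (b : ι → Γ(M, U))
    (hb : ∀ (V : X.Opens) (hV : V ≤ U), Function.Bijective fun a : ι → Γ(X, V) =>
      ∑ i, a i • M.presheaf.map (homOfLE hV).op (b i))
    (hc : ∀ (V : X.Opens) (hV : V ≤ U), Function.Bijective fun a : ι → Γ(X, V) =>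
      ∑ i, a i • N.presheaf.map (homOfLE hV).op (φ.app U (b i)))
    (V : X.Opens) (hV : V ≤ U) : Function.Bijective (φ.app V) := by
  have heq : (fun a : ι → Γ(X, V) => ∑ i, a i • N.presheaf.map (homOfLE hV).op (φ.app U (b i))) =
      φ.app V ∘ fun a : ι → Γ(X, V) => ∑ i, a i • M.presheaf.map (homOfLE hV).op (b i) := by
    funext a
    exact (app_sum_smul_map φ hV b a).symm
  have h := hc V hV
  rw [heq] at h
  exact (Function.Bijective.of_comp_iff _ (hb V hV)).mp h

/-- Frames transport along isomorphisms. [cite: GortzWedhorn2023, proof of Thm. 24.94 and Prop. 24.95 (pp. 566–567), auxiliary step] -/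
theorem frame_map_iso {M N : X.Modules} (e : M ≅ N) {U : X.Opens} (b : ι → Γ(M, U))
    (hb : ∀ (V : X.Opens) (hV : V ≤ U), Function.Bijective fun a : ι → Γ(X, V) =>
      ∑ i, a i • M.presheaf.map (homOfLE hV).op (b i)) :
    ∀ (V : X.Opens) (hV : V ≤ U), Function.Bijective fun a : ι → Γ(X, V) =>
      ∑ i, a i • N.presheaf.map (homOfLE hV).op (e.hom.app U (b i)) :=
  frame_map_of_app_bijective e.hom b hb fun V _ => app_bijective_of_iso e V

/-- Frames restrict to smaller opens. [cite: GortzWedhorn2023, proof of Thm. 24.94 and Prop. 24.95 (pp. 566–567), auxiliary step] -/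
theorem frame_restrict {M : X.Modules} {U U' : X.Opens} (hU : U' ≤ U) (b : ι → Γ(M, U))
    (hb : ∀ (V : X.Opens) (hV : V ≤ U), Function.Bijective fun a : ι → Γ(X, V) =>
      ∑ i, a i • M.presheaf.map (homOfLE hV).op (b i)) :
    ∀ (V : X.Opens) (hV : V ≤ U'), Function.Bijective fun a : ι → Γ(X, V) =>
      ∑ i, a i • M.presheaf.map (homOfLE hV).op (M.presheaf.map (homOfLE hU).op (b i)) := by
  intro V hV
  have heq : ∀ i, M.presheaf.map (homOfLE hV).op (M.presheaf.map (homOfLE hU).op (b i)) =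
      M.presheaf.map (homOfLE (hV.trans hU)).op (b i) := fun i => by
    rw [← CategoryTheory.comp_apply, ← Functor.map_comp]
    rfl
  simp_rw [heq]
  exact hb V (hV.trans hU)

/-- Restricting a section along `V ≤ V' ≤ V` gives it back. [cite: GortzWedhorn2023, proof of Thm. 24.94 and Prop. 24.95 (pp. 566–567), auxiliary step] -/
theorem map_map_of_le_of_le (M : X.Modules) {V V' : X.Opens} (h₁ : V ≤ V') (h₂ : V' ≤ V)
    (x : Γ(M, V)) : M.presheaf.map (homOfLE h₁).op (M.presheaf.map (homOfLE h₂).op x) = x := by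
  rw [← CategoryTheory.comp_apply, ← Functor.map_comp]
  change M.presheaf.map (homOfLE h₁ ≫ homOfLE h₂).op x = x
  rw [Subsingleton.elim (homOfLE h₁ ≫ homOfLE h₂) (𝟙 V)]
  change (M.presheaf.map (𝟙 (op V))) x = x
  rw [CategoryTheory.Functor.map_id]
  rfl

/-- Restricting a function along `V ≤ V' ≤ V` gives it back. [cite: GortzWedhorn2023, proof of Thm. 24.94 and Prop. 24.95 (pp. 566–567), auxiliary step] -/
theorem ringMap_map_of_le_of_le {V V' : X.Opens} (h₁ : V ≤ V') (h₂ : V' ≤ V) (r : Γ(X, V)) :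
    X.presheaf.map (homOfLE h₁).op (X.presheaf.map (homOfLE h₂).op r) = r := by
  rw [← CategoryTheory.comp_apply, ← Functor.map_comp]
  change X.presheaf.map (homOfLE h₁ ≫ homOfLE h₂).op r = r
  rw [Subsingleton.elim (homOfLE h₁ ≫ homOfLE h₂) (𝟙 V)]
  change (X.presheaf.map (𝟙 (op V))) r = r
  rw [CategoryTheory.Functor.map_id]
  rfl

/-- Restriction maps of a module along parallel arrows of opens agree (opens form a preorder). [cite: GortzWedhorn2023, proof of Thm. 24.94 and Prop. 24.95 (pp. 566–567), auxiliary step] -/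
theorem presheaf_map_congr (M : X.Modules) {A B : (X.Opens)ᵒᵖ} (f g : A ⟶ B) (x : M.presheaf.obj A) :
    M.presheaf.map f x = M.presheaf.map g x :=
  congrArg (fun h => M.presheaf.map h x) (Quiver.Hom.unop_inj (Subsingleton.elim _ _))

/-- Frame bijectivity at an open `V'` passes to an open `V` with `V ≤ V' ≤ V` (restriction along an
equality of opens, phrased without `eqToHom`). [cite: GortzWedhorn2023, proof of Thm. 24.94 and Prop. 24.95 (pp. 566–567), auxiliary step] -/
theorem sum_smul_bijective_of_le_of_le {M : X.Modules} {V V' : X.Opens} (h₁ : V ≤ V')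
    (h₂ : V' ≤ V) (m : ι → Γ(M, V'))
    (hm : Function.Bijective fun a : ι → Γ(X, V') => ∑ i, a i • m i) :
    Function.Bijective fun a : ι → Γ(X, V) =>
      ∑ i, a i • M.presheaf.map (homOfLE h₁).op (m i) := by
  have key : ∀ a : ι → Γ(X, V), (∑ i, a i • M.presheaf.map (homOfLE h₁).op (m i)) =
      M.presheaf.map (homOfLE h₁).op (∑ i, X.presheaf.map (homOfLE h₂).op (a i) • m i) := by
    intro a
    rw [map_sum]
    refine Finset.sum_congr rfl fun i _ => ?_
    rw [Scheme.Modules.map_smul, ringMap_map_of_le_of_le]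
  constructor
  · intro a a' h
    simp only [key] at h
    have h' := congrArg (M.presheaf.map (homOfLE h₂).op) h
    rw [map_map_of_le_of_le, map_map_of_le_of_le] at h'
    have h'' := hm.1 h'
    funext i
    have hi := congrArg (X.presheaf.map (homOfLE h₁).op) (congrFun h'' i)
    rwa [ringMap_map_of_le_of_le, ringMap_map_of_le_of_le] at hi
  · intro x
    obtain ⟨a', ha'⟩ := hm.2 (M.presheaf.map (homOfLE h₂).op x)
    refine ⟨fun i => X.presheaf.map (homOfLE h₁).op (a' i), ?_⟩
    change (∑ i, _ • _) = x
    rw [key]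
    simp_rw [ringMap_map_of_le_of_le]
    change M.presheaf.map (homOfLE h₁).op ((fun a : ι → Γ(X, V') => ∑ i, a i • m i) a') = x
    rw [ha', map_map_of_le_of_le]

end Transport

/-! ### The standard frame of `𝒪^ι = ∐ 𝒪` -/

section Free

variable {ι : Type u} [Fintype ι]

/-- `ιᵢ(r) = r • ιᵢ(1)` for the coprojections of `𝒪^ι`. [cite: GortzWedhorn2023, proof of Thm. 24.94 and Prop. 24.95 (pp. 566–567), auxiliary step] -/
theorem sigmaι_app_eq_smul (U : X.Opens) (r : Γ(X, U)) (i : ι) :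
    (Sigma.ι (fun _ : ι => unitModule X) i).app U r =
      r • (Sigma.ι (fun _ : ι => unitModule X) i).app U (1 : Γ(X, U)) := by
  rw [← Scheme.Modules.Hom.app_smul]
  exact congrArg _ (mul_one r).symm

/-- The coprojections of `𝒪^ι` restrict along opens to the coprojections. [cite: GortzWedhorn2023, proof of Thm. 24.94 and Prop. 24.95 (pp. 566–567), auxiliary step] -/
theorem map_sigmaι_app_one {U V : X.Opens} (hV : V ≤ U) (i : ι) :
    (∐ fun _ : ι => unitModule X).presheaf.map (homOfLE hV).op
      ((Sigma.ι (fun _ : ι => unitModule X) i).app U (1 : Γ(X, U))) =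
      (Sigma.ι (fun _ : ι => unitModule X) i).app V (1 : Γ(X, V)) := by
  rw [← Scheme.Modules.Hom.app_map_apply]
  exact congrArg _ (map_one (X.presheaf.map (homOfLE hV).op).hom)

/-- **Sections of `𝒪^ι` are the `ι`-tuples of functions**: `a ↦ ∑ i, ιᵢ(aᵢ)` is a bijection
`(ι → Γ(X, U)) → Γ(𝒪^ι, U)` (the projections `𝒪^ι → 𝒪` give the inverse). [cite: GortzWedhorn2023, proof of Thm. 24.94 and Prop. 24.95 (pp. 566–567), auxiliary step] -/
theorem sum_sigmaι_app_bijective (U : X.Opens) :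
    Function.Bijective fun a : ι → Γ(X, U) =>
      ∑ i, (Sigma.ι (fun _ : ι => unitModule X) i).app U (a i) := by
  classical
  let π : ι → ((∐ fun _ : ι => unitModule X) ⟶ unitModule X) := fun j =>
    Sigma.desc (fun k : ι => if k = j then 𝟙 (unitModule X) else 0)
  have hπι : ∀ (i j : ι) (r : Γ(X, U)),
      (π j).app U ((Sigma.ι (fun _ : ι => unitModule X) i).app U r) = if i = j then r else 0 := by
    intro i j r
    have h := congrArg (fun φ => φ.app U r)
      (Sigma.ι_desc (fun k : ι => if k = j then 𝟙 (unitModule X) else 0) i)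
    simp only [app_comp_apply] at h
    rw [h]
    split_ifs
    · rfl
    · rfl
  have hπ : ∀ (a : ι → Γ(X, U)) (j : ι),
      (π j).app U (∑ i, (Sigma.ι (fun _ : ι => unitModule X) i).app U (a i)) = a j := by
    intro a j
    rw [map_sum]
    calc ∑ i, (π j).app U ((Sigma.ι (fun _ : ι => unitModule X) i).app U (a i))
        = ∑ i, (if i = j then a i else 0) := Finset.sum_congr rfl (fun i _ => hπι i j (a i))
      _ = a j := by simp
  have hid : ∑ j, π j ≫ Sigma.ι (fun _ : ι => unitModule X) j = 𝟙 (∐ fun _ : ι => unitModule X) := by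
    refine Sigma.hom_ext _ _ fun i => ?_
    simp only [Preadditive.comp_sum, Category.comp_id, Sigma.ι_desc_assoc, π]
    rw [Finset.sum_eq_single i]
    · simp
    · intro b _ hb
      rw [if_neg (Ne.symm hb), zero_comp]
    · intro h
      exact absurd (Finset.mem_univ i) h
  constructor
  · intro a a' h
    funext j
    rw [← hπ a j, ← hπ a' j]
    exact congrArg _ h
  · intro s
    refine ⟨fun i => (π i).app U s, ?_⟩
    have h := congrArg (fun φ => φ.app U s) hid
    simp only [Scheme.Modules.Hom.id_app, sum_app_apply, app_comp_apply] at h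
    exact h

/-- **The standard frame of `𝒪^ι`**: the sections `ιᵢ(1)` over `U` form a frame over `U`. [cite: GortzWedhorn2023, proof of Thm. 24.94 and Prop. 24.95 (pp. 566–567), auxiliary step] -/
theorem frame_sigmaι (U : X.Opens) :
    ∀ (V : X.Opens) (hV : V ≤ U), Function.Bijective fun a : ι → Γ(X, V) =>
      ∑ i, a i • (∐ fun _ : ι => unitModule X).presheaf.map (homOfLE hV).op
        ((Sigma.ι (fun _ : ι => unitModule X) i).app U (1 : Γ(X, U))) := by
  intro V hV
  have heq : (fun a : ι → Γ(X, V) =>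
      ∑ i, a i • (∐ fun _ : ι => unitModule X).presheaf.map (homOfLE hV).op
        ((Sigma.ι (fun _ : ι => unitModule X) i).app U (1 : Γ(X, U)))) =
      fun a : ι → Γ(X, V) => ∑ i, (Sigma.ι (fun _ : ι => unitModule X) i).app V (a i) := by
    funext a
    refine Finset.sum_congr rfl fun i _ => ?_
    rw [map_sigmaι_app_one, ← sigmaι_app_eq_smul]
  rw [heq]
  exact sum_sigmaι_app_bijective V

/-- **A frame over `⊤` trivialises the module**: if `c` is a frame of `M` over `⊤`, there is an
isomorphism `𝒪^ι ≅ M` carrying `ιᵢ(1)` to `c i`. [cite: GortzWedhorn2023, proof of Thm. 24.94 and Prop. 24.95 (pp. 566–567), auxiliary step] -/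
theorem exists_sigmaIso_of_frame_top {M : X.Modules} (c : ι → Γ(M, ⊤))
    (hc : ∀ (V : X.Opens) (hV : V ≤ ⊤), Function.Bijective fun a : ι → Γ(X, V) =>
      ∑ i, a i • M.presheaf.map (homOfLE hV).op (c i)) :
    ∃ φ : (∐ fun _ : ι => unitModule X) ≅ M,
      ∀ i, φ.hom.app ⊤ ((Sigma.ι (fun _ : ι => unitModule X) i).app ⊤ (1 : Γ(X, ⊤))) = c i := by
  -- the morphisms `𝒪 → M` classified by the global sections `c i`
  let sec : ι → M.sections := fun i =>
    PresheafOfModules.sectionsMk (fun O => M.presheaf.map (homOfLE (le_top (a := O.unop))).op (c i))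
      (by
        intro O O' f
        change M.presheaf.map f (M.presheaf.map (homOfLE _).op (c i)) = _
        rw [← CategoryTheory.comp_apply, ← Functor.map_comp]
        rfl)
  let g : ι → (unitModule X ⟶ M) := fun i => M.unitHomEquiv.symm (sec i)
  have hg1 : ∀ (i : ι) (O : X.Opens), (g i).app O (1 : Γ(X, O)) =
      M.presheaf.map (homOfLE (le_top (a := O))).op (c i) := by
    intro i O
    have h := SheafOfModules.unitHomEquiv_apply_coe M (g i) (op O)
    rw [show M.unitHomEquiv (g i) = sec i from Equiv.apply_symm_apply _ _] at h
    exact h.symm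
  have hg : ∀ (i : ι) (O : X.Opens) (r : Γ(X, O)), (g i).app O r =
      r • M.presheaf.map (homOfLE (le_top (a := O))).op (c i) := by
    intro i O r
    rw [← hg1, ← Scheme.Modules.Hom.app_smul]
    exact congrArg _ (mul_one r).symm
  let φ : (∐ fun _ : ι => unitModule X) ⟶ M := Sigma.desc g
  have hφ : ∀ i, φ.app ⊤ ((Sigma.ι (fun _ : ι => unitModule X) i).app ⊤ (1 : Γ(X, ⊤))) = c i := by
    intro i
    rw [← app_comp_apply, Sigma.ι_desc, hg1]
    change (M.presheaf.map (𝟙 (op ⊤))) (c i) = c i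
    rw [CategoryTheory.Functor.map_id]
    rfl
  -- `φ` carries the standard frame to the frame `c`, so it is bijective on all opens
  have hbij : ∀ V : X.Opens, Function.Bijective (φ.app V) := fun V =>
    app_bijective_of_frame_of_frame φ _ (frame_sigmaι ⊤) (by simp_rw [hφ]; exact hc) V le_top
  haveI : IsIso φ := Scheme.Modules.Hom.isIso_iff_isIso_app.mpr fun V =>
    (ConcreteCategory.isIso_iff_bijective _).mpr (hbij V)
  exact ⟨asIso φ, hφ⟩

end Free

/-! ### Registered sub-goal -/

/-- **Registered sub-goal** (helper stub of `stub_pushforwardTransport`, universe `0`): a frame over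
`⊤` is the image of the standard frame of `𝒪^ι` under an isomorphism `𝒪^ι ≅ M`
(`exists_sigmaIso_of_frame_top`). [cite: GortzWedhorn2023, proof of Thm. 24.94 and Prop. 24.95 (pp. 566–567), auxiliary step] -/
theorem stub_sigmaIsoOfFrameTop :
    ∀ (X : AlgebraicGeometry.Scheme.{0}) (ι : Type) [Fintype ι] (M : X.Modules)
      (c : ι → M.presheaf.obj (Opposite.op ⊤)),
      (∀ (V : X.Opens) (hV : V ≤ ⊤), Function.Bijective fun a : ι → X.presheaf.obj (Opposite.op V) =>
        ∑ i, a i • M.presheaf.map (CategoryTheory.homOfLE hV).op (c i)) →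
      ∃ φ : (∐ fun _ : ι => Literature.AlgebraicGeometry.Modules.unitModule X) ≅ M,
        ∀ i, φ.hom.app ⊤ ((CategoryTheory.Limits.Sigma.ι
          (fun _ : ι => Literature.AlgebraicGeometry.Modules.unitModule X) i).app ⊤
            (1 : X.presheaf.obj (Opposite.op ⊤))) = c i :=
  fun _ _ _ _ c hc => exists_sigmaIso_of_frame_top c hc

end Literature.AlgebraicGeometry.FormalGeometry.WittGrothendieckExistence.FormalVectorBundlesAlgebraize

end
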